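import Literature.MathematicalPhysics.QuantumFieldTheory.VillainSpinWaveKernelBounds
import HarnessLib

/-!
# The flux-gas side of the Villain two-plaquette function: splitting the gas averages into `⟨cos cos⟩` and `⟨sin sin⟩`

Companion of `VillainSheetDuality` / `VillainSpinWaveKernelBounds`.  In Fröhlich–Spencer's dual model the two-plaquette function of
the Villain cube is `½e^{−(E_p+E_q)/2β}(e^{B/β}A(δ_p−δ_q) − e^{−B/β}A(δ_p+δ_q))` with the flux-gas (monopole) averages
`A(S) = ⟨cos⟨ξ_⊥, S⟩⟩_g = (∑_ξ g(ξ) cos⟨(2πξ)_⊥, S⟩)/(∑_ξ g(ξ))`.  Writing `φ_a(ξ) = ⟨(2πξ)_⊥, a⟩` (the "disorder phase" of the sheet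
`a`, FS82 (2.90): the dual observable `α(μ)`), the addition theorem gives the form in which the monopole content separates:

* `gasAverage_sub_eq_add`, `gasAverage_add_eq_sub`: `A(a ∓ b) = ⟨cos φ_a cos φ_b⟩_g ± ⟨sin φ_a sin φ_b⟩_g`;
* **`half_exp_gas_sub_exp_gas_eq`**: `½(e^{x}A(a−b) − e^{−x}A(a+b)) = sinh x · ⟨cos φ_a cos φ_b⟩_g + cosh x · ⟨sin φ_a sin φ_b⟩_g`;
* `abs_gasCosCos_le_one`, `abs_gasSinSin_le_one`: both gas correlations have modulus `≤ 1`.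

So the Villain two-plaquette function is `e^{−(E_p+E_q)/2β}[sinh(B/β)·⟨cos φ_p cos φ_q⟩_g + cosh(B/β)·⟨sin φ_p sin φ_q⟩_g]`: the spin wave
`sinh(B/β)` dressed by the amplitude `⟨cos φ_p cos φ_q⟩_g` (→ renormalised coupling), plus the monopole dipole–dipole term
`⟨sin φ_p sin φ_q⟩_g`.  Exact finite-volume identities; no estimate of the gas.  Everything is proved; no named fact is introduced.

## References

* J. Fröhlich, T. Spencer, Comm. Math. Phys. 83 (1982) 411–454, §2.4 (2.24), §2.11 (2.89)–(2.91) (the two-plaquette function and the dual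
  quantity `⟨|α(μ)|²⟩(β)`). [FrohlichSpencerCMP1982]
-/

noncomputable section

open Finset Function Matrix
open scoped Real
open Literature.Probability.LatticeModels
open Literature.Probability.LatticeModels.GaussianCoord (exactPart perpPart exactEnergy)

namespace Literature.MathematicalPhysics.QuantumFieldTheory

namespace VillainAngle

open AxialGauge LatticeForm VillainFibre

variable {d n : ℕ} {β : ℝ}

/-! ### Summability of bounded gas observables -/

/-- A gas observable bounded by `1` in modulus is summable against the Coulomb weights. [cite: FrohlichSpencerCMP1982, §2.4 (2.24)] -/
theorem summable_coulombWeight_mul_of_abs_le_one (hβ : 0 < β)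
    {F : (PIdx d n → ℤ) ⧸ (dFree (d := d) (n := n)).range → ℝ} (hF : ∀ ξ, |F ξ| ≤ 1) :
    Summable fun ξ => coulombWeight β ξ * F ξ := by
  refine Summable.of_norm_bounded (summable_coulombWeight hβ) fun ξ => ?_
  rw [Real.norm_eq_abs, abs_mul, abs_of_pos (coulombWeight_pos hβ ξ)]
  exact mul_le_of_le_one_right (coulombWeight_pos hβ ξ).le (hF ξ)

/-- `|∑_ξ g(ξ) F(ξ)| ≤ ∑_ξ g(ξ)` for `|F| ≤ 1`. [cite: FrohlichSpencerCMP1982, §2.4 (2.24)] -/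
theorem abs_tsum_coulombWeight_mul_le (hβ : 0 < β)
    {F : (PIdx d n → ℤ) ⧸ (dFree (d := d) (n := n)).range → ℝ} (hF : ∀ ξ, |F ξ| ≤ 1) :
    |∑' ξ, coulombWeight β ξ * F ξ| ≤ ∑' ξ : (PIdx d n → ℤ) ⧸ (dFree (d := d) (n := n)).range, coulombWeight β ξ := by
  have hs := summable_coulombWeight_mul_of_abs_le_one hβ hF
  have h1 := norm_tsum_le_tsum_norm hs.norm
  rw [Real.norm_eq_abs] at h1
  refine h1.trans (hs.norm.tsum_le_tsum (fun ξ => ?_) (summable_coulombWeight hβ))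
  rw [Real.norm_eq_abs, abs_mul, abs_of_pos (coulombWeight_pos hβ ξ)]
  exact mul_le_of_le_one_right (coulombWeight_pos hβ ξ).le (hF ξ)

/-! ### The addition theorem inside the gas averages -/

/-- **`A(a − b) = ⟨cos φ_a cos φ_b⟩ + ⟨sin φ_a sin φ_b⟩`** (numerators): `∑ g cos(φ_a − φ_b) = ∑ g cos φ_a cos φ_b + ∑ g sin φ_a sin φ_b`.
[cite: FrohlichSpencerCMP1982, §2.11 (2.90)] -/
theorem tsum_coulombWeight_cos_sub (hβ : 0 < β) (a b : PIdx d n → ℝ) :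
    ∑' ξ : (PIdx d n → ℤ) ⧸ (dFree (d := d) (n := n)).range,
        coulombWeight β ξ * Real.cos (perpPart dMat (fluxRep ξ) ⬝ᵥ (a - b)) =
      ∑' ξ : (PIdx d n → ℤ) ⧸ (dFree (d := d) (n := n)).range,
          coulombWeight β ξ * (Real.cos (perpPart dMat (fluxRep ξ) ⬝ᵥ a) * Real.cos (perpPart dMat (fluxRep ξ) ⬝ᵥ b)) +
        ∑' ξ : (PIdx d n → ℤ) ⧸ (dFree (d := d) (n := n)).range,
          coulombWeight β ξ * (Real.sin (perpPart dMat (fluxRep ξ) ⬝ᵥ a) * Real.sin (perpPart dMat (fluxRep ξ) ⬝ᵥ b)) := by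
  have hcc := summable_coulombWeight_mul_of_abs_le_one hβ (F := fun ξ =>
    Real.cos (perpPart dMat (fluxRep ξ) ⬝ᵥ a) * Real.cos (perpPart dMat (fluxRep ξ) ⬝ᵥ b)) fun ξ => by
      rw [abs_mul]; exact mul_le_one₀ (Real.abs_cos_le_one _) (abs_nonneg _) (Real.abs_cos_le_one _)
  have hss := summable_coulombWeight_mul_of_abs_le_one hβ (F := fun ξ =>
    Real.sin (perpPart dMat (fluxRep ξ) ⬝ᵥ a) * Real.sin (perpPart dMat (fluxRep ξ) ⬝ᵥ b)) fun ξ => by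
      rw [abs_mul]; exact mul_le_one₀ (Real.abs_sin_le_one _) (abs_nonneg _) (Real.abs_sin_le_one _)
  rw [← hcc.tsum_add hss]
  refine tsum_congr fun ξ => ?_
  rw [dotProduct_sub, Real.cos_sub]
  ring

/-- **`A(a + b) = ⟨cos φ_a cos φ_b⟩ − ⟨sin φ_a sin φ_b⟩`** (numerators). [cite: FrohlichSpencerCMP1982, §2.11 (2.90)] -/
theorem tsum_coulombWeight_cos_add (hβ : 0 < β) (a b : PIdx d n → ℝ) :
    ∑' ξ : (PIdx d n → ℤ) ⧸ (dFree (d := d) (n := n)).range,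
        coulombWeight β ξ * Real.cos (perpPart dMat (fluxRep ξ) ⬝ᵥ (a + b)) =
      ∑' ξ : (PIdx d n → ℤ) ⧸ (dFree (d := d) (n := n)).range,
          coulombWeight β ξ * (Real.cos (perpPart dMat (fluxRep ξ) ⬝ᵥ a) * Real.cos (perpPart dMat (fluxRep ξ) ⬝ᵥ b)) -
        ∑' ξ : (PIdx d n → ℤ) ⧸ (dFree (d := d) (n := n)).range,
          coulombWeight β ξ * (Real.sin (perpPart dMat (fluxRep ξ) ⬝ᵥ a) * Real.sin (perpPart dMat (fluxRep ξ) ⬝ᵥ b)) := by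
  have hcc := summable_coulombWeight_mul_of_abs_le_one hβ (F := fun ξ =>
    Real.cos (perpPart dMat (fluxRep ξ) ⬝ᵥ a) * Real.cos (perpPart dMat (fluxRep ξ) ⬝ᵥ b)) fun ξ => by
      rw [abs_mul]; exact mul_le_one₀ (Real.abs_cos_le_one _) (abs_nonneg _) (Real.abs_cos_le_one _)
  have hss := summable_coulombWeight_mul_of_abs_le_one hβ (F := fun ξ =>
    Real.sin (perpPart dMat (fluxRep ξ) ⬝ᵥ a) * Real.sin (perpPart dMat (fluxRep ξ) ⬝ᵥ b)) fun ξ => by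
      rw [abs_mul]; exact mul_le_one₀ (Real.abs_sin_le_one _) (abs_nonneg _) (Real.abs_sin_le_one _)
  rw [← hcc.tsum_sub hss]
  refine tsum_congr fun ξ => ?_
  rw [dotProduct_add, Real.cos_add]
  ring

/-- **The gas side of the two-plaquette function, separated.**  For `β > 0`, sheets `a, b` and any real `x`,
`½(e^{x}·A(a−b) − e^{−x}·A(a+b)) = sinh x · ⟨cos φ_a cos φ_b⟩_g + cosh x · ⟨sin φ_a sin φ_b⟩_g`
(`A(S) = (∑_ξ g(ξ)cos⟨ξ_⊥,S⟩)/(∑_ξ g(ξ))`, `⟨F⟩_g = (∑_ξ g(ξ)F(ξ))/(∑_ξ g(ξ))`, `φ_a(ξ) = ⟨ξ_⊥, a⟩`).  With `x = B/β`, `a = δ_p`,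
`b = δ_q` this is the bracket of `zdVillainExpect_im_mul_im_eq_spinWave_gas`: the spin wave `sinh(B/β)` carries the amplitude
`⟨cos φ_p cos φ_q⟩_g`, and `cosh(B/β)·⟨sin φ_p sin φ_q⟩_g` is the monopole dipole–dipole term. [cite: FrohlichSpencerCMP1982, §2.11 (2.89)–(2.91)] -/
theorem half_exp_gas_sub_exp_gas_eq (hβ : 0 < β) (a b : PIdx d n → ℝ) (x : ℝ) :
    1 / 2 * (Real.exp x *
        ((∑' ξ : (PIdx d n → ℤ) ⧸ (dFree (d := d) (n := n)).range,
            coulombWeight β ξ * Real.cos (perpPart dMat (fluxRep ξ) ⬝ᵥ (a - b))) /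
          ∑' ξ : (PIdx d n → ℤ) ⧸ (dFree (d := d) (n := n)).range, coulombWeight β ξ) -
      Real.exp (-x) *
        ((∑' ξ : (PIdx d n → ℤ) ⧸ (dFree (d := d) (n := n)).range,
            coulombWeight β ξ * Real.cos (perpPart dMat (fluxRep ξ) ⬝ᵥ (a + b))) /
          ∑' ξ : (PIdx d n → ℤ) ⧸ (dFree (d := d) (n := n)).range, coulombWeight β ξ)) =
      Real.sinh x *
          ((∑' ξ : (PIdx d n → ℤ) ⧸ (dFree (d := d) (n := n)).range,
              coulombWeight β ξ * (Real.cos (perpPart dMat (fluxRep ξ) ⬝ᵥ a) * Real.cos (perpPart dMat (fluxRep ξ) ⬝ᵥ b))) /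
            ∑' ξ : (PIdx d n → ℤ) ⧸ (dFree (d := d) (n := n)).range, coulombWeight β ξ) +
        Real.cosh x *
          ((∑' ξ : (PIdx d n → ℤ) ⧸ (dFree (d := d) (n := n)).range,
              coulombWeight β ξ * (Real.sin (perpPart dMat (fluxRep ξ) ⬝ᵥ a) * Real.sin (perpPart dMat (fluxRep ξ) ⬝ᵥ b))) /
            ∑' ξ : (PIdx d n → ℤ) ⧸ (dFree (d := d) (n := n)).range, coulombWeight β ξ) := by
  rw [tsum_coulombWeight_cos_sub hβ, tsum_coulombWeight_cos_add hβ, Real.sinh_eq, Real.cosh_eq]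
  have hZ := (tsum_coulombWeight_pos (d := d) (n := n) hβ).ne'
  field_simp
  ring

/-- `|⟨cos φ_a cos φ_b⟩_g| ≤ 1`. [cite: FrohlichSpencerCMP1982, §2.4 (2.24)] -/
theorem abs_gasCosCos_le_one (hβ : 0 < β) (a b : PIdx d n → ℝ) :
    |(∑' ξ : (PIdx d n → ℤ) ⧸ (dFree (d := d) (n := n)).range,
          coulombWeight β ξ * (Real.cos (perpPart dMat (fluxRep ξ) ⬝ᵥ a) * Real.cos (perpPart dMat (fluxRep ξ) ⬝ᵥ b))) /
        ∑' ξ : (PIdx d n → ℤ) ⧸ (dFree (d := d) (n := n)).range, coulombWeight β ξ| ≤ 1 := by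
  have hZ := tsum_coulombWeight_pos (d := d) (n := n) hβ
  rw [abs_div, abs_of_pos hZ, div_le_one hZ]
  exact abs_tsum_coulombWeight_mul_le hβ fun ξ => by
    rw [abs_mul]; exact mul_le_one₀ (Real.abs_cos_le_one _) (abs_nonneg _) (Real.abs_cos_le_one _)

/-- `|⟨sin φ_a sin φ_b⟩_g| ≤ 1`. [cite: FrohlichSpencerCMP1982, §2.4 (2.24)] -/
theorem abs_gasSinSin_le_one (hβ : 0 < β) (a b : PIdx d n → ℝ) :
    |(∑' ξ : (PIdx d n → ℤ) ⧸ (dFree (d := d) (n := n)).range,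
          coulombWeight β ξ * (Real.sin (perpPart dMat (fluxRep ξ) ⬝ᵥ a) * Real.sin (perpPart dMat (fluxRep ξ) ⬝ᵥ b))) /
        ∑' ξ : (PIdx d n → ℤ) ⧸ (dFree (d := d) (n := n)).range, coulombWeight β ξ| ≤ 1 := by
  have hZ := tsum_coulombWeight_pos (d := d) (n := n) hβ
  rw [abs_div, abs_of_pos hZ, div_le_one hZ]
  exact abs_tsum_coulombWeight_mul_le hβ fun ξ => by
    rw [abs_mul]; exact mul_le_one₀ (Real.abs_sin_le_one _) (abs_nonneg _) (Real.abs_sin_le_one _)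

/-- **The two-plaquette function, gas-separated form.**  For `β > 0` and plaquettes `p, q` of `B_n`, with `E_p, E_q, B` as in
`zdVillainExpect_im_mul_im_eq_spinWave_gas` and `φ_p(ξ) = ((2πξ)_⊥)_p`:
`⟨Im U_p Im U_q⟩_{B_n}(β) = e^{−(E_p+E_q)/2β} [ sinh(B/β)·⟨cos φ_p cos φ_q⟩_g + cosh(B/β)·⟨sin φ_p sin φ_q⟩_g ]`.
[cite: FrohlichSpencerCMP1982, §2.11 (2.89)–(2.91)] -/
theorem zdVillainExpect_im_mul_im_eq_gasSplit (hβ : 0 < β) (p q : PIdx d n) :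
    zdVillainExpect β (halfOpenBox d n) (fun U =>
        ((U.plaquette p.1.1 p.1.2.1 p.1.2.2 : Circle) : ℂ).im *
          ((U.plaquette q.1.1 q.1.2.1 q.1.2.2 : Circle) : ℂ).im) =
      Real.exp (-(exactEnergy dMat (Pi.single p (1 : ℝ)) + exactEnergy dMat (Pi.single q (1 : ℝ))) / (2 * β)) *
        (Real.sinh (((dMatᵀ *ᵥ (Pi.single p (1 : ℝ) : PIdx d n → ℝ)) ⬝ᵥ
              ((Literature.Probability.LatticeModels.GaussianCoord.gram (dMat (d := d) (n := n)))⁻¹ *ᵥ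
                (dMatᵀ *ᵥ (Pi.single q (1 : ℝ) : PIdx d n → ℝ)))) / β) *
            ((∑' ξ : (PIdx d n → ℤ) ⧸ (dFree (d := d) (n := n)).range,
                coulombWeight β ξ * (Real.cos (perpPart dMat (fluxRep ξ) ⬝ᵥ (Pi.single p (1 : ℝ) : PIdx d n → ℝ)) *
                  Real.cos (perpPart dMat (fluxRep ξ) ⬝ᵥ (Pi.single q (1 : ℝ) : PIdx d n → ℝ)))) /
              ∑' ξ : (PIdx d n → ℤ) ⧸ (dFree (d := d) (n := n)).range, coulombWeight β ξ) +
          Real.cosh (((dMatᵀ *ᵥ (Pi.single p (1 : ℝ) : PIdx d n → ℝ)) ⬝ᵥ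
              ((Literature.Probability.LatticeModels.GaussianCoord.gram (dMat (d := d) (n := n)))⁻¹ *ᵥ
                (dMatᵀ *ᵥ (Pi.single q (1 : ℝ) : PIdx d n → ℝ)))) / β) *
            ((∑' ξ : (PIdx d n → ℤ) ⧸ (dFree (d := d) (n := n)).range,
                coulombWeight β ξ * (Real.sin (perpPart dMat (fluxRep ξ) ⬝ᵥ (Pi.single p (1 : ℝ) : PIdx d n → ℝ)) *
                  Real.sin (perpPart dMat (fluxRep ξ) ⬝ᵥ (Pi.single q (1 : ℝ) : PIdx d n → ℝ)))) /
              ∑' ξ : (PIdx d n → ℤ) ⧸ (dFree (d := d) (n := n)).range, coulombWeight β ξ)) := by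
  rw [zdVillainExpect_im_mul_im_eq_spinWave_gas hβ p q]
  have hsub : (fun r => ((Pi.single p (1 : ℤ) - Pi.single q 1 : PIdx d n → ℤ) r : ℝ)) =
      (Pi.single p (1 : ℝ) : PIdx d n → ℝ) - Pi.single q 1 := by
    funext r
    simp only [Pi.sub_apply, Int.cast_sub]
    by_cases hp : r = p <;> by_cases hq : r = q <;> subst_vars <;> simp_all
  have hadd : (fun r => ((Pi.single p (1 : ℤ) + Pi.single q 1 : PIdx d n → ℤ) r : ℝ)) =
      (Pi.single p (1 : ℝ) : PIdx d n → ℝ) + Pi.single q 1 := by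
    funext r
    simp only [Pi.add_apply, Int.cast_add]
    by_cases hp : r = p <;> by_cases hq : r = q <;> subst_vars <;> simp_all
  rw [hsub, hadd, neg_div, mul_assoc (1 / 2 : ℝ), ← half_exp_gas_sub_exp_gas_eq hβ]
  ring

end VillainAngle

end Literature.MathematicalPhysics.QuantumFieldTheory
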